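import Literature.AlgebraicGeometry.Motives.HodgeLieOfAbelianVarietyBiproduct
import Literature.AlgebraicGeometry.Motives.HodgeLieDiagonal
import HarnessLib

/-!
# The Hodge group of a power: `dim Lie Hg(H¹(B^{a+1})) = dim Lie Hg(H¹B)`, and `dim Lie Hg(H¹X) = dim Lie Hg(H¹B)`
# for every complex abelian variety `X` isogenous to a power of `B`

Family `hodge`, layer `Literature/AlgebraicGeometry/Motives`; THEOREMS ONLY (no definition, no named fact).  Written for
the cell `pub-hodgecm2` (COR-CM), seat `b27` gen 42 (count-neutral Mumford–Tate-rank ladder).  Sequel of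
`Motives/HodgeLieOfAbelianVarietyBiproduct` (gen 35), which proved the inequality
`dim Lie Hg(H¹(⨁_{Fin (a+1)} B)) ≤ dim Lie Hg(H¹B)` (`finrank_hodgeLie_hodge_one_biproduct_const_le`); the reverse
inequality is the diagonal embedding `Δ 𝔥(H) ⊆ 𝔥(H^{⊕ι})` of `Motives/HodgeLieDiagonal`
(`HodgeStructure.finrank_hodgeLie_pi_const_eq`, Moonen 1999 (1.8): «`MT(V^{⊕n})` is isomorphic to `MT(V)` acting
diagonally»), transported along Künneth in degree one (`pi_hodge_one_eq_comapEquiv_biproduct`).  For complex abelian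
varieties this is `Hg(Bⁿ) = Hg(B)` (Moonen–Zarhin 1999 §3, first paragraph).

* **`finrank_hodgeLie_hodge_one_biproduct_const_eq`** — `dim_ℚ Lie Hg(H¹(⨁_{Fin (a+1)} B)) = dim_ℚ Lie Hg(H¹B)`;
* **`finrank_hodgeLie_hodge_one_eq_of_isIsogenous_biproduct_const`** — `dim_ℚ Lie Hg(H¹X) = dim_ℚ Lie Hg(H¹B)` for
  `X ∼ ⨁_{Fin (a+1)} B` (isogeny invariance, `finrank_hodgeLie_hodge_one_eq_of_isIsogenous`).
The Mumford–Tate-rank form `dim MT(H¹X) = dim MT(H¹B)` (`dim MT = dim Lie Hg + 1` for `0 < dim`) is drawn on the Summit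
side (`Summit.HodgeConjecture.CorCM.mtRank_hodge_one_eq_of_isIsogenous_biproduct_const`).

## References
* [MoonenZarhin1999LowDim] B. Moonen, Yu. Zarhin, *Hodge classes on abelian varieties of low dimension*, Math. Ann. 315
  (1999), §1 («For `n ≥ 1` we can identify `Hg(Xⁿ)` with `Hg(X)`, acting diagonally on `V_{Xⁿ} = (V_X)ⁿ`»)
  [corpus: paper:arxiv-math_9901113 p. 2] and §3 first paragraph (`Hg(X₁ × X₂) ⊆ Hg(X₁) × Hg(X₂)`).
  [cite: MoonenZarhin1999LowDim, §1 and §3]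
* [Moonen1999MTNotes] B. Moonen, *Notes on Mumford–Tate groups* (1999), (1.8). [cite: Moonen1999MTNotes, (1.8)]
* [Deligne1982HodgeCycles] P. Deligne, *Hodge cycles on abelian varieties*, LNM 900 (1982), I §3.1 and Prop. 3.4.
  [cite: Deligne1982HodgeCycles, I §3.1 and Prop. 3.4]
* [VoisinHodgeI2002] C. Voisin, *Hodge Theory and Complex Algebraic Geometry I*, §7.3.2 and Thm. 11.40 (Künneth).
  [cite: VoisinHodgeI2002, §7.3.2]
-/

noncomputable section

open CategoryTheory CategoryTheory.Limits

namespace Literature.AlgebraicGeometry.Motives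

namespace AbelianVariety

open Literature.AlgebraicGeometry.HodgeTheory
open Literature.AlgebraicGeometry.Motives.HodgeStructure

variable [HodgeTensorFacts.{0, 0}]

section Const

variable {B : AbelianVariety ℂ} {k a m : ℕ} (hBsp : IsSmoothProjective k B.X)
  (hP : IsSmoothProjective m (⨁ fun _ : Fin (a + 1) => B).X)

/-- **`dim Lie Hg(H¹(⨁_{Fin (a+1)} B)) = dim Lie Hg(H¹B)`** — the Lie-algebra form of `Hg(Bⁿ) = Hg(B)`: Künneth in degree one
identifies `H¹(⨁ B)` with the constant direct sum `⊕_{Fin (a+1)} H¹(B)` of Hodge structures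
(`pi_hodge_one_eq_comapEquiv_biproduct`), the dimension of `Lie Hg` is an isomorphism invariant
(`finrank_hodgeLie_comapEquiv`), and `dim 𝔥(H^{⊕ι}) = dim 𝔥(H)` (`HodgeStructure.finrank_hodgeLie_pi_const_eq`).
[cite: MoonenZarhin1999LowDim, §1 and §3] [cite: Moonen1999MTNotes, (1.8)] [cite: Deligne1982HodgeCycles, I §3.1 and Prop. 3.4] -/
theorem finrank_hodgeLie_hodge_one_biproduct_const_eq :
    haveI := BettiUniverse.finite hP 1
    haveI := BettiUniverse.finite hBsp 1
    Module.finrank ℚ (BettiUniverse.hodge exists_isReal_hodgeModel_holds hP 1).hodgeLie =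
      Module.finrank ℚ (BettiUniverse.hodge exists_isReal_hodgeModel_holds hBsp 1).hodgeLie := by
  haveI := BettiUniverse.finite hP 1
  haveI := BettiUniverse.finite hBsp 1
  have hpi := pi_hodge_one_eq_comapEquiv_biproduct (A := fun _ : Fin (a + 1) => B) (fun _ => hBsp) hP
    exists_isReal_hodgeModel_holds hodgePQ_independent_of_hodgeModel_holds
  have heq := finrank_hodgeLie_comapEquiv (BettiUniverse.hodge exists_isReal_hodgeModel_holds hP 1)
    (LinearEquiv.ofBijective
      (∑ c, BettiUniverse.pull (biproduct.π (fun _ : Fin (a + 1) => B) c).hom.hom.hom 1 ∘ₗ LinearMap.proj c :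
        (∀ _ : Fin (a + 1), bettiCohomology B.X 1) →ₗ[ℚ] bettiCohomology (⨁ fun _ : Fin (a + 1) => B).X 1)
      (bijective_sum_pull_biproduct_π fun _ : Fin (a + 1) => B))
  rw [← hpi] at heq
  rw [← heq]
  exact finrank_hodgeLie_pi_const_eq _

/-- **`dim Lie Hg(H¹X) = dim Lie Hg(H¹B)` for a complex abelian variety `X` isogenous to `⨁_{Fin (a+1)} B`** (isogeny
invariance `finrank_hodgeLie_hodge_one_eq_of_isIsogenous` and `finrank_hodgeLie_hodge_one_biproduct_const_eq`).
[cite: MoonenZarhin1999LowDim, §1 and §3] [cite: Deligne1982HodgeCycles, I Prop. 3.4] [cite: VoisinHodgeI2002, §7.3.2] -/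
theorem finrank_hodgeLie_hodge_one_eq_of_isIsogenous_biproduct_const {X : AbelianVariety ℂ} {n' : ℕ}
    (hX : IsSmoothProjective n' X.X) (h : IsIsogenous X (⨁ fun _ : Fin (a + 1) => B)) :
    haveI := BettiUniverse.finite hX 1
    haveI := BettiUniverse.finite hBsp 1
    Module.finrank ℚ (BettiUniverse.hodge exists_isReal_hodgeModel_holds hX 1).hodgeLie =
      Module.finrank ℚ (BettiUniverse.hodge exists_isReal_hodgeModel_holds hBsp 1).hodgeLie := by
  have hP' : IsSmoothProjective (⨁ fun _ : Fin (a + 1) => B).dim (⨁ fun _ : Fin (a + 1) => B).X :=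
    AbelianVariety.isSmoothProjective_holds
  rw [finrank_hodgeLie_hodge_one_eq_of_isIsogenous hX hP' h]
  exact finrank_hodgeLie_hodge_one_biproduct_const_eq hBsp hP'

end Const

end AbelianVariety

end Literature.AlgebraicGeometry.Motives

end
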